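import Mathlib
import Summits.MatrixMultiplication.MatrixMultiplication.Theorems.SnSubsetDichotomyHyperoctahedralThresholdStubBadCount

/-!
# `SnSubsetDichotomy.HyperoctahedralThreshold` — rigidity already implies poorness

Helper (`--supports`) for the open core `stub_poorRigidCore` of the refutation line
`refutation-local-symmetry` of crux `stmt-MatrixMultiplication-10883` (skeleton
`Cruxes/HyperoctahedralThreshold/Lines/refutation_local_symmetry.lean`; siege seat k17).

Vocabulary of the line: three fixed-point-free involutions `μ 0, μ 1, μ 2` of `Fin n`; a colour
word `z : List (Fin 3)` acts on the right, `x · z := z.foldl (fun v c => μ c v) x`; `z` is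
cyclically reduced when `List.IsChain (· ≠ ·) (z ++ z)`; the trajectory of a fixed point `x` of
`z` is `t ↦ x · z.take t` (`t < |z|`) and its *pattern* is the relation
`x · z.take s = x · z.take t` on positions.

The open core carries two hypotheses on the host (besides `|R| ≤ n^{3/4}`):
* POOR — every nonempty cyclically reduced `z` with `|z| ≤ n^{1/4}` has at most
  `(4|z|²)^(⌊log₂|z|⌋+1) · (|R| + 1)` distinct fixed points;
* RIGID — for such `z`, every family of distinct fixed points with pairwise identical patterns
  has at most `2|z||R| + |z|² + 1` members.

`poor_of_rigid` : RIGID ⇒ POOR (for any real length cap `L` in place of `n^{1/4}`), so POOR is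
redundant in the core and the residual statement is "RIGID ⇒ one clean closed rung walk".
Proof (the halving recursion behind the line's `richDescent`, run on RIGID instead of on a rich
word): split the fixed points of `z` (`|z| = ℓ ≥ 2`) into GOOD ones (injective trajectory) and
BAD ones.  All good points have the same (discrete) pattern, so RIGID bounds them by
`2ℓ|R| + ℓ² + 1`.  By the landed `stub_badCount` (p-tree theorem of this line) the bad ones number
at most `C(ℓ,2) · M` as soon as every nonempty cyclically reduced `τ` with `2|τ| ≤ ℓ` has at most
`M` fixed points, and by induction on the length `M := A(⌊ℓ/2⌋)(|R|+1)` works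
(`A j = (4j²)^(⌊log₂ j⌋+1)` is monotone, `PoorOfRigid.thresholdA_mono`).  The arithmetic
`C(ℓ,2)·A(⌊ℓ/2⌋)(|R|+1) + (2ℓ|R| + ℓ² + 1) ≤ A(ℓ)(|R|+1)` is `PoorOfRigid.thresholdA_step₂`.
`stub_poorOfRigid` is the same statement with the cap `L = n^{1/4}` and the hypotheses spelled
exactly as in `stub_poorRigidCore`.  Pure finite combinatorics. [this line; folklore]
-/

-- the project's summit namespace `Summit.MatrixMultiplication.MatrixMultiplication` repeats a component by design (D-0022)
set_option linter.dupNamespace false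

namespace Summit.MatrixMultiplication.MatrixMultiplication.Theorems.HyperoctahedralThreshold

namespace PoorOfRigid

/-- A nonempty cyclically reduced word has length `≥ 2` (a single letter `c` would give `c ≠ c`
across the wrap). [folklore] -/
theorem two_le_length_of_isChain {z : List (Fin 3)} (hz : z ≠ [])
    (hc : List.IsChain (· ≠ ·) (z ++ z)) : 2 ≤ z.length := by
  match z, hz, hc with
  | [a], _, hc => simp at hc
  | a :: b :: t, _, _ => simp

-- adapted from Cruxes/HyperoctahedralThreshold/Lines/refutation_local_symmetry.lean (`thresholdA_mono`)
/-- Monotonicity of the threshold `A ℓ r = (4ℓ²)^(⌊log₂ ℓ⌋+1)·(r+1)` in `ℓ`. [this line] -/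
theorem thresholdA_mono {j ℓ : ℕ} (h : j ≤ ℓ) (r : ℕ) :
    (4 * j ^ 2) ^ (Nat.log 2 j + 1) * (r + 1) ≤ (4 * ℓ ^ 2) ^ (Nat.log 2 ℓ + 1) * (r + 1) := by
  apply Nat.mul_le_mul_right
  rcases Nat.eq_zero_or_pos ℓ with rfl | hℓ
  · obtain rfl : j = 0 := Nat.le_zero.1 h
    exact le_rfl
  calc (4 * j ^ 2) ^ (Nat.log 2 j + 1) ≤ (4 * ℓ ^ 2) ^ (Nat.log 2 j + 1) := by gcongr
    _ ≤ (4 * ℓ ^ 2) ^ (Nat.log 2 ℓ + 1) :=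
        Nat.pow_le_pow_right (by positivity) (Nat.add_le_add_right (Nat.log_mono_right h) 1)

-- adapted from Cruxes/HyperoctahedralThreshold/Lines/refutation_local_symmetry.lean (`thresholdA_step`)
/-- The arithmetic of one halving step with the RIGID constant:
`C(ℓ,2)·A(ℓ/2)·(r+1) + (2ℓr + ℓ² + 1) ≤ A(ℓ)·(r+1)` for `ℓ ≥ 2`. [this line] -/
theorem thresholdA_step₂ {ℓ : ℕ} (hℓ : 2 ≤ ℓ) (r : ℕ) :
    ℓ.choose 2 * ((4 * (ℓ / 2) ^ 2) ^ (Nat.log 2 (ℓ / 2) + 1) * (r + 1)) + (2 * (ℓ * r) + ℓ ^ 2 + 1)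
      ≤ (4 * ℓ ^ 2) ^ (Nat.log 2 ℓ + 1) * (r + 1) := by
  set d : ℕ := Nat.log 2 ℓ with hd
  have hd1 : 1 ≤ d := Nat.log_pos one_lt_two hℓ
  have hdd : Nat.log 2 (ℓ / 2) + 1 = d := by
    rw [Nat.log_div_base]; omega
  rw [hdd]
  have hL : 1 ≤ ℓ ^ 2 := Nat.one_le_pow _ _ (by omega)
  have h1 : 4 * (ℓ / 2) ^ 2 ≤ ℓ ^ 2 := by
    have e : 4 * (ℓ / 2) ^ 2 = (ℓ / 2 * 2) ^ 2 := by ring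
    rw [e]
    exact Nat.pow_le_pow_left (Nat.div_mul_le_self ℓ 2) 2
  have hM : (4 * (ℓ / 2) ^ 2) ^ d * (r + 1) ≤ (ℓ ^ 2) ^ d * (r + 1) := by gcongr
  have hC : ℓ.choose 2 ≤ ℓ ^ 2 := by
    rw [Nat.choose_two_right]
    calc ℓ * (ℓ - 1) / 2 ≤ ℓ * (ℓ - 1) := Nat.div_le_self _ _
      _ ≤ ℓ * ℓ := Nat.mul_le_mul_left _ (Nat.sub_le _ _)
      _ = ℓ ^ 2 := (sq ℓ).symm
  have hT1 : ℓ.choose 2 * ((4 * (ℓ / 2) ^ 2) ^ d * (r + 1)) ≤ (ℓ ^ 2) ^ (d + 1) * (r + 1) := by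
    calc ℓ.choose 2 * ((4 * (ℓ / 2) ^ 2) ^ d * (r + 1)) ≤ ℓ ^ 2 * ((ℓ ^ 2) ^ d * (r + 1)) :=
          Nat.mul_le_mul hC hM
      _ = (ℓ ^ 2) ^ (d + 1) * (r + 1) := by ring
  have hpow : ℓ ^ 2 * ℓ ^ 2 ≤ (ℓ ^ 2) ^ (d + 1) := by
    calc ℓ ^ 2 * ℓ ^ 2 = (ℓ ^ 2) ^ 2 := by ring
      _ ≤ (ℓ ^ 2) ^ (d + 1) := Nat.pow_le_pow_right hL (by omega)
  have hT2 : 2 * (ℓ * r) + ℓ ^ 2 + 1 ≤ (ℓ ^ 2) ^ (d + 1) * (r + 1) := by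
    have h4 : 4 ≤ ℓ ^ 2 := by
      calc 4 = 2 ^ 2 := by norm_num
        _ ≤ ℓ ^ 2 := Nat.pow_le_pow_left hℓ 2
    have hlL : 2 * ℓ ≤ ℓ ^ 2 := by
      calc 2 * ℓ ≤ ℓ * ℓ := Nat.mul_le_mul_right ℓ hℓ
        _ = ℓ ^ 2 := (sq ℓ).symm
    have hr2 : r + 2 ≤ ℓ ^ 2 * (r + 1) :=
      calc r + 2 ≤ 4 * (r + 1) := by omega
        _ ≤ ℓ ^ 2 * (r + 1) := Nat.mul_le_mul_right _ h4
    have : 2 * (ℓ * r) + ℓ ^ 2 + 1 ≤ ℓ ^ 2 * ℓ ^ 2 * (r + 1) :=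
      calc 2 * (ℓ * r) + ℓ ^ 2 + 1 = (2 * ℓ) * r + ℓ ^ 2 + 1 := by ring
        _ ≤ ℓ ^ 2 * r + ℓ ^ 2 + ℓ ^ 2 :=
            Nat.add_le_add (Nat.add_le_add (Nat.mul_le_mul_right r hlL) le_rfl) hL
        _ = ℓ ^ 2 * (r + 2) := by ring
        _ ≤ ℓ ^ 2 * (ℓ ^ 2 * (r + 1)) := Nat.mul_le_mul_left _ hr2
        _ = ℓ ^ 2 * ℓ ^ 2 * (r + 1) := by ring
    exact this.trans (Nat.mul_le_mul_right _ hpow)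
  have h2 : 2 * (ℓ ^ 2) ^ (d + 1) ≤ (4 * ℓ ^ 2) ^ (d + 1) := by
    rw [mul_pow]
    apply Nat.mul_le_mul_right
    calc 2 ≤ 4 ^ 1 := by norm_num
      _ ≤ 4 ^ (d + 1) := Nat.pow_le_pow_right (by norm_num) (by omega)
  calc ℓ.choose 2 * ((4 * (ℓ / 2) ^ 2) ^ d * (r + 1)) + (2 * (ℓ * r) + ℓ ^ 2 + 1)
      ≤ (ℓ ^ 2) ^ (d + 1) * (r + 1) + (ℓ ^ 2) ^ (d + 1) * (r + 1) := Nat.add_le_add hT1 hT2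
    _ = (2 * (ℓ ^ 2) ^ (d + 1)) * (r + 1) := by ring
    _ ≤ (4 * ℓ ^ 2) ^ (d + 1) * (r + 1) := Nat.mul_le_mul_right _ h2

end PoorOfRigid

open PoorOfRigid in
/-- **Rigidity implies poorness.**  Let `μ 0, μ 1, μ 2` be fixed-point-free involutions of
`Fin n`, `R` a finite set and `L` a real length cap.  If every nonempty cyclically reduced word
`z` with `|z| ≤ L` satisfies the RIGID bound — every family of distinct fixed points with pairwise
identical self-coincidence patterns has at most `2|z||R| + |z|² + 1` members — then every such
`z` satisfies the POOR bound: at most `(4|z|²)^(⌊log₂|z|⌋+1)·(|R|+1)` distinct fixed points.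
(Good fixed points form one pattern class; bad ones are charged to shorter words by
`stub_badCount` and induction on `|z|`.) [this line] -/
theorem poor_of_rigid (n : ℕ) (μ : Fin 3 → Equiv.Perm (Fin n))
    (hμ : ∀ i, μ i * μ i = 1 ∧ ∀ v, μ i v ≠ v) (R : Finset (Fin n)) (L : ℝ)
    (hrig : ∀ z : List (Fin 3), z ≠ [] → List.IsChain (· ≠ ·) (z ++ z) → (z.length : ℝ) ≤ L →
      ∀ (m : ℕ) (x : Fin m → Fin n), Function.Injective x →
      (∀ i, z.foldl (fun v c => μ c v) (x i) = x i) →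
      (∀ i j, ∀ s t : Fin z.length,
        ((z.take (s : ℕ)).foldl (fun v c => μ c v) (x i) = (z.take (t : ℕ)).foldl (fun v c => μ c v) (x i) ↔
          (z.take (s : ℕ)).foldl (fun v c => μ c v) (x j) = (z.take (t : ℕ)).foldl (fun v c => μ c v) (x j))) →
      m ≤ 2 * (z.length * R.card) + z.length ^ 2 + 1) :
    ∀ z : List (Fin 3), z ≠ [] → List.IsChain (· ≠ ·) (z ++ z) → (z.length : ℝ) ≤ L →
      ∀ (m : ℕ) (x : Fin m → Fin n), Function.Injective x →
      (∀ i, z.foldl (fun v c => μ c v) (x i) = x i) →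
      m ≤ (4 * z.length ^ 2) ^ (Nat.log 2 z.length + 1) * (R.card + 1) := by
  have hinv : ∀ c, μ c * μ c = 1 := fun c => (hμ c).1
  have hfpf : ∀ c v, μ c v ≠ v := fun c v => (hμ c).2 v
  suffices H : ∀ (ℓ : ℕ) (z : List (Fin 3)), z.length = ℓ → z ≠ [] → List.IsChain (· ≠ ·) (z ++ z) →
      (z.length : ℝ) ≤ L → ∀ (m : ℕ) (x : Fin m → Fin n), Function.Injective x →
      (∀ i, z.foldl (fun v c => μ c v) (x i) = x i) →
      m ≤ (4 * z.length ^ 2) ^ (Nat.log 2 z.length + 1) * (R.card + 1) by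
    intro z hz0 hzc hzL m x hx hfix
    exact H z.length z rfl hz0 hzc hzL m x hx hfix
  intro ℓ
  induction ℓ using Nat.strong_induction_on with
  | _ ℓ ih =>
  intro z hzl hz0 hzc hzL m x hx hfix
  classical
  have hz2 : 2 ≤ z.length := two_le_length_of_isChain hz0 hzc
  have hℓ2 : 2 ≤ ℓ := hzl ▸ hz2
  -- good and bad fixed points
  let good : Finset (Fin m) := Finset.univ.filter
    (fun i => Function.Injective (fun t : Fin z.length => (z.take (t : ℕ)).foldl (fun v c => μ c v) (x i)))
  let bad : Finset (Fin m) := Finset.univ.filter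
    (fun i => ¬ Function.Injective (fun t : Fin z.length => (z.take (t : ℕ)).foldl (fun v c => μ c v) (x i)))
  have hsplit : good.card + bad.card = m := by
    have := Finset.card_filter_add_card_filter_not (s := (Finset.univ : Finset (Fin m)))
      (fun i => Function.Injective (fun t : Fin z.length => (z.take (t : ℕ)).foldl (fun v c => μ c v) (x i)))
    simpa using this
  -- the good ones form a single pattern class: RIGID
  have hgood : good.card ≤ 2 * (z.length * R.card) + z.length ^ 2 + 1 := by
    let e := (Finset.equivFin good).symm
    let x' : Fin good.card → Fin n := fun j => x (e j).1
    have hx' : Function.Injective x' := by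
      intro j j' h
      exact e.injective (Subtype.ext (hx h))
    have hfix' : ∀ j, z.foldl (fun v c => μ c v) (x' j) = x' j := fun j => hfix _
    have hinj' : ∀ j, Function.Injective
        (fun t : Fin z.length => (z.take (t : ℕ)).foldl (fun v c => μ c v) (x' j)) :=
      fun j => (Finset.mem_filter.1 (e j).2).2
    have hpat : ∀ i j, ∀ s t : Fin z.length,
        ((z.take (s : ℕ)).foldl (fun v c => μ c v) (x' i) = (z.take (t : ℕ)).foldl (fun v c => μ c v) (x' i) ↔
          (z.take (s : ℕ)).foldl (fun v c => μ c v) (x' j) = (z.take (t : ℕ)).foldl (fun v c => μ c v) (x' j)) :=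
      fun i j s t => (hinj' i).eq_iff.trans (hinj' j).eq_iff.symm
    exact hrig z hz0 hzc hzL good.card x' hx' hfix' hpat
  -- the bad ones are charged to shorter words: `stub_badCount` with the inductive bound
  set M₀ : ℕ := (4 * (ℓ / 2) ^ 2) ^ (Nat.log 2 (ℓ / 2) + 1) * (R.card + 1) with hM₀
  have hpoor : ∀ τ : List (Fin 3), τ ≠ [] → 2 * τ.length ≤ z.length → List.IsChain (· ≠ ·) (τ ++ τ) →
      ∀ (m' : ℕ) (y : Fin m' → Fin n), Function.Injective y →
      (∀ i, τ.foldl (fun v c => μ c v) (y i) = y i) → m' ≤ M₀ := by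
    intro τ hτ0 hτlen hτc m' y hy hyfix
    have hτ2 : 2 ≤ τ.length := two_le_length_of_isChain hτ0 hτc
    have hτlt : τ.length < ℓ := by omega
    have hτhalf : τ.length ≤ ℓ / 2 := by omega
    have hτL : (τ.length : ℝ) ≤ L := by
      have : (τ.length : ℝ) ≤ (z.length : ℝ) := by exact_mod_cast (by omega : τ.length ≤ z.length)
      exact this.trans hzL
    have h := ih τ.length hτlt τ rfl hτ0 hτc hτL m' y hy hyfix
    exact h.trans (thresholdA_mono hτhalf R.card)
  have hbad : bad.card ≤ z.length.choose 2 * M₀ := by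
    let e := (Finset.equivFin bad).symm
    let x' : Fin bad.card → Fin n := fun j => x (e j).1
    have hx' : Function.Injective x' := by
      intro j j' h
      exact e.injective (Subtype.ext (hx h))
    have hfix' : ∀ j, z.foldl (fun v c => μ c v) (x' j) = x' j := fun j => hfix _
    have hninj' : ∀ j, ¬ Function.Injective
        (fun t : Fin z.length => (z.take (t : ℕ)).foldl (fun v c => μ c v) (x' j)) :=
      fun j => (Finset.mem_filter.1 (e j).2).2
    exact stub_badCount n μ z M₀ bad.card x' hinv hfpf hz2 hzc hpoor hx' hfix' hninj'
  have hstep := thresholdA_step₂ hℓ2 R.card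
  rw [← hM₀] at hstep
  rw [hzl] at hgood hbad ⊢
  omega

/-- **`stub_poorOfRigid`** — `poor_of_rigid` with the cap `n^{1/4}` and the two hypotheses spelled
verbatim as in the open core `stub_poorRigidCore`: its POOR hypothesis follows from its RIGID
hypothesis, for every host, every `R` and every `n` (no largeness needed). [this line] -/
theorem stub_poorOfRigid : ∀ (n : ℕ) (μ : Fin 3 → Equiv.Perm (Fin n)), (∀ i, μ i * μ i = 1 ∧ ∀ v, μ i v ≠ v) → ∀ R : Finset (Fin n), (∀ z : List (Fin 3), z ≠ [] → List.IsChain (· ≠ ·) (z ++ z) → (z.length : ℝ) ≤ (n : ℝ) ^ ((1 : ℝ) / 4) → ∀ (m : ℕ) (x : Fin m → Fin n), Function.Injective x → (∀ i, z.foldl (fun v c => μ c v) (x i) = x i) → (∀ i j, ∀ s t : Fin z.length, ((z.take (s : ℕ)).foldl (fun v c => μ c v) (x i) = (z.take (t : ℕ)).foldl (fun v c => μ c v) (x i) ↔ (z.take (s : ℕ)).foldl (fun v c => μ c v) (x j) = (z.take (t : ℕ)).foldl (fun v c => μ c v) (x j))) → m ≤ 2 * (z.length * R.card) + z.length ^ 2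 + 1) → (∀ z : List (Fin 3), z ≠ [] → List.IsChain (· ≠ ·) (z ++ z) → (z.length : ℝ) ≤ (n : ℝ) ^ ((1 : ℝ) / 4) → ∀ (m : ℕ) (x : Fin m → Fin n), Function.Injective x → (∀ i, z.foldl (fun v c => μ c v) (x i) = x i) → m ≤ (4 * z.length ^ 2) ^ (Nat.log 2 z.length + 1) * (R.card + 1)) :=
  fun n μ hμ R hrig => poor_of_rigid n μ hμ R ((n : ℝ) ^ ((1 : ℝ) / 4)) hrig

end Summit.MatrixMultiplication.MatrixMultiplication.Theorems.HyperoctahedralThreshold
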